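import Literature.NumberTheory.EllipticCurves.RootNumber
import Literature.NumberTheory.EllipticCurves.LFunctionSmulProofs
import Literature.NumberTheory.DiophantineGeometry.TateAlgorithmInvarianceProofs
import Literature.NumberTheory.DiophantineGeometry.MinimalDiscriminantSmulProofs
import HarnessLib

/-!
# The global root number is an isomorphism invariant — discharge of `rootNumber_smul`

Trunk T-ELLARITH / `EllArithM` (companion proof file of
`Literature.NumberTheory.EllipticCurves.RootNumber`; theorems only). Kept apart from
`RootNumberProofs` because it needs the heavy import
`Literature.NumberTheory.DiophantineGeometry.TateAlgorithmInvarianceProofs` (well-definedness of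
Tate's algorithm) and `LFunctionSmulProofs` (which itself imports `RootNumberProofs`).

`WeierstrassCurve.rootNumber_smul_holds` discharges the named fact
`WeierstrassCurve.rootNumber_smul`: for an elliptic `W / ℚ` and `C : VariableChange ℚ`,
`(C • W).rootNumber = W.rootNumber`.

## Proof architecture

`W.rootNumber` is the sign of the functional equation of an entire continuation of the raw
completed `L`-function `W.completedLFunction (W.conductorNorm ℤ)` (`HasFunctionalEquationSign`,
`completedLContinuations`), so it depends on `W` only through the pair
(`WeierstrassCurve.completedLFunction N W`, `N = W.conductorNorm ℤ`). Silverman, AEC App. C §16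
(PDF pp. 390–391) defines `L_{E/K}(s)`, the conductor `N_{E/K}` and
`ξ_E(s) = N_E^{s/2}(2π)^{-s}Γ(s)L_E(s)` from the reduction of *a* minimal model at each finite
place; both are isomorphism invariants because a minimal equation is unique up to a change of
coordinates `u ∈ R*`, `r, s, t ∈ R` (Prop. VII.1.3(b), PDF p. 165).

* the completed `L`-function of a fixed level is invariant: `completedLFunction_smul`
  (`Literature…LFunctionSmulProofs`, from `LFunction_smul`);
* the conductor is invariant: `conductor_smul` of `Literature…Conductor` takes as hypotheses the
  named facts `ordMinimalDiscriminant_smul` (discharged in `MinimalDiscriminantSmulProofs`) and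
  `kodairaSymbol_smul` over every completed local ring `O_v` (discharged in
  `TateAlgorithmInvarianceProofs`, perfect residue field; over `ℚ` the residue fields `𝔽_p` are
  finite hence perfect, instance `Literature.NumberTheory.DiophantineGeometry.Rat.finite_residueField_adicCompletionIntegers`). We record
  the resulting unconditional forms `conductorExponent_smul'`, `conductor_smul'`,
  `conductorNorm_smul` over any Dedekind domain with perfect residue fields at all places;
* hence `HasFunctionalEquationSign` and `rootNumber` agree on `W` and `C • W`
  (`hasFunctionalEquationSign_smul_iff`, `rootNumber_smul_holds`).

## References

* J. H. Silverman, *The Arithmetic of Elliptic Curves*, GTM 106, 2nd ed. 2009: App. C §16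
  (PDF pp. 390–391: `L_{E/K}`, `N_{E/K}`, Thm. 16.3 functional equation with sign `w = ±1`),
  Prop. VII.1.3(b) (PDF p. 165). [cite: SilvermanAEC2009, App. C §16]
* J. Tate, Algorithm for determining the type of a singular fiber in an elliptic pencil, 1975.
-/

namespace WeierstrassCurve

open IsDedekindDomain

/-! ### Unconditional invariance of the conductor -/

section Conductor

variable {A : Type*} [CommRing A] [IsDedekindDomain A] {K : Type*} [Field K]
  [Algebra A K] [IsFractionRing A K]

/-- The conductor exponent `f_v` is an isomorphism invariant of an elliptic `W / K` at a place `v`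
with perfect residue field of the completion (unconditional form of `conductorExponent_smul`, the
named facts `ordMinimalDiscriminant_smul`, `kodairaSymbol_smul` being discharged by
`ordMinimalDiscriminant_smul_holds`, `kodairaSymbol_smul_holds`). Silverman AEC C.16 / ATAEC IV.10.
[cite: SilvermanAEC2009, App. C §16 (PDF pp. 390–391) with VII.1 Prop. 1.3(b)] -/
theorem conductorExponent_smul' (v : HeightOneSpectrum A) (W : WeierstrassCurve K)
    [PerfectField (IsLocalRing.ResidueField (v.adicCompletionIntegers K))]
    [W.IsElliptic] (C : VariableChange K) :
    (C • W).conductorExponent v = W.conductorExponent v :=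
  conductorExponent_smul v W (ordMinimalDiscriminant_smul_holds v W)
    (kodairaSymbol_smul_holds (v.adicCompletionIntegers K)) C

variable (A)
variable
  [∀ v : HeightOneSpectrum A, PerfectField (IsLocalRing.ResidueField (v.adicCompletionIntegers K))]
  (W : WeierstrassCurve K) [W.IsElliptic] (C : VariableChange K)

/-- The conductor ideal `𝔣(E/K)` is an isomorphism invariant of an elliptic `W / K` (perfect
residue fields; unconditional form of `conductor_smul`). Silverman AEC C.16 / ATAEC IV.10.
[cite: SilvermanAEC2009, App. C §16 (PDF pp. 390–391)] -/
theorem conductor_smul' : (C • W).conductor A = W.conductor A :=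
  conductor_smul A W (fun v ↦ ordMinimalDiscriminant_smul_holds v W)
    (fun v ↦ kodairaSymbol_smul_holds (v.adicCompletionIntegers K)) C

/-- The conductor norm `N(𝔣(E/K))` (over `ℚ`: the conductor `N_E`) is an isomorphism invariant of
an elliptic `W / K` (perfect residue fields). Silverman AEC C.16.
[cite: SilvermanAEC2009, App. C §16 (PDF pp. 390–391)] -/
theorem conductorNorm_smul [Module.Free ℤ A] : (C • W).conductorNorm A = W.conductorNorm A := by
  simp only [conductorNorm, conductor_smul' A W C]

end Conductor

/-! ### The root number over `ℚ` -/

section Rat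

variable (W : WeierstrassCurve ℚ)

section IsElliptic

variable [W.IsElliptic] (C : VariableChange ℚ)

/-- Over `ℚ` the conductor `N_E ∈ ℕ` is an isomorphism invariant (the residue fields `𝔽_p` of the
completions `ℤ_p` are finite, hence perfect). Silverman AEC C.16.
[cite: SilvermanAEC2009, App. C §16 (PDF pp. 390–391)] -/
theorem conductorNorm_int_smul : (C • W).conductorNorm ℤ = W.conductorNorm ℤ :=
  conductorNorm_smul ℤ W C

/-- The set of entire continuations of the completed `L`-function of a fixed level `N` is an
isomorphism invariant (from `completedLFunction_smul`). [folklore] -/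
theorem completedLContinuations_smul (N : ℕ) :
    (C • W).completedLContinuations N = W.completedLContinuations N := by
  simp only [completedLContinuations, completedLFunction_smul]

/-- The chosen entire continuation of the completed `L`-function of level `N` (including its junk
branch) is an isomorphism invariant. [folklore] -/
theorem completedLContinuation_smul (N : ℕ) :
    (C • W).completedLContinuation N = W.completedLContinuation N := by
  unfold completedLContinuation
  rw [completedLContinuations_smul, completedLFunction_smul]

/-- `HasFunctionalEquationSign ε` (functional equation of the completed `L`-function at level the
conductor, with sign `ε`) is an isomorphism invariant of an elliptic `W / ℚ`: both the completed
`L`-function and the conductor are. Silverman AEC C.16, Thm. 16.3.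
[cite: SilvermanAEC2009, App. C §16 (PDF pp. 390–391)] -/
theorem hasFunctionalEquationSign_smul_iff (ε : ℤ) :
    (C • W).HasFunctionalEquationSign ε ↔ W.HasFunctionalEquationSign ε := by
  simp only [HasFunctionalEquationSign, completedLContinuations_smul, conductorNorm_int_smul]

end IsElliptic

/-- **Discharge of the named fact `WeierstrassCurve.rootNumber_smul`**: the global root number
`w(E/ℚ)` (sign of the functional equation) is an isomorphism invariant of an elliptic `W / ℚ`,
because the `L`-function (`LFunction_smul`) and the conductor (`conductorNorm_smul`, via the
well-definedness of Tate's algorithm `kodairaSymbol_smul_holds` and `ordMinimalDiscriminant_smul_holds`)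
are. Silverman AEC App. C §16 (book pp. 449–451, PDF pp. 390–391: definition of `L_{E/K}`,
`f_v`, `N_{E/K}`, `ξ_E(s) = N_E^{s/2}(2π)^{-s}Γ(s)L_E(s)` and Thm. 16.3, the sign `w = ±1` of the
functional equation `ξ_E(s) = w ξ_E(2 − s)`), all attached to the isomorphism class of `E` via
Prop. VII.1.3(b) (PDF p. 165: a minimal equation is unique up to `u ∈ R*`, `r, s, t ∈ R`).
[cite: SilvermanAEC2009, App. C §16 Thm. 16.3 (PDF pp. 390–391) with Prop. VII.1.3(b)] -/
theorem rootNumber_smul_holds : W.rootNumber_smul := by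
  intro C _
  unfold rootNumber
  by_cases h : W.HasFunctionalEquationSign (-1)
  · rw [if_pos h, if_pos ((hasFunctionalEquationSign_smul_iff W C (-1)).mpr h)]
  · rw [if_neg h, if_neg (mt (hasFunctionalEquationSign_smul_iff W C (-1)).mp h)]

end Rat

end WeierstrassCurve
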